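import Summits.AtomisticToContinuum.Crystallization.Theorems.FreeSplittingCertificatesStrictSplittingRuleTorusModel442Defs
import Summits.AtomisticToContinuum.Crystallization.Theorems.FreeSplittingCertificatesStrictSplittingRuleTorusModel442TablesLam2

/-!
# The joint (r6) sitewise LMI on the hcp torus 4×4×2 with the κ-demand DOUBLED — model-level theorem (feasibility factor ≥ 2)

Route `FreeSplittingCertificates`, crux `StrictSplittingRule` (stmt-AtomisticToContinuum-12560); unit b2b-freesplit-B (block 2b,
PART B, gen 1).  **VALUE = a kernel-accepted (computational lane) theorem about a FINITE model — NOT summit progress.**  It does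
not prove the registered stub `stub_coreJointCoercive`.

Same model as `…TorusModel442Defs.lean` (read its header), with the κ-part of the demand scaled by `λ = 2`
(`(κ₁, κ₃) = (2/3, 1/6)` instead of the registered `(1/3, 1/12)`), the readout form unchanged, and the witness transfer tables
`tableRaw442lam2` (kit job j038967).  Theorems (both parities): for every displacement field `u`,
`2·K_p(u) + R_p(u) + m₂‖u‖²_G ≤ S_p(u) + T⁽²⁾_p(u) + meanProj(u)` with `m₂ = 14843/2²⁰ = 0.01416` (`K_p` = κ-demand at the registered
constants, `R_p` = readout form, `T⁽²⁾` = transfers of the λ = 2 tables), and the zero-mean forms.  This is the model-level version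
of "feasibility factor ≥ 2 on 4×4×2" (CERT.md §8b; float optimum 0.01618, here certified with margin 0.01416).  Proof: as in
`…TorusModel442A.lean` — `evalQ_nonneg_of_certDD` + one `native_decide` of `PSD.IsGramCertDD` per parity (COMPUTATIONAL, `Lean.ofReduceBool`).
-/

namespace Summit.AtomisticToContinuum.Crystallization.Theorems.StrictSplittingRuleTorusLMI

open Literature.Computation.Certificates

/-- Decoded λ = 2 transfer classes. [folklore] -/
def tableClassesLam2 : List (Bool × Off × Bool × Bool × List ℤ) :=
  tableRaw442lam2.filterMap fun r =>
    match r with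
    | b :: dk :: di :: dj :: bq :: full :: ents => some (b == 1, (dk, di, dj), bq == 1, full == 1, ents)
    | _ => none

/-- The certified margin for λ = 2: `m₂ = 14843/2²⁰ = 0.014155…`. -/
def margin442lam2 : ℚ := 14843 / 2 ^ 20

/-- κ-DEMAND `K_p(u) = κ₁Σ⟨V s, e_s⟩² + κ₃Σ‖e_s − W V s‖²` at the registered constants. [folklore] -/
def kappaDemand (p : Site) (u : Fin 192 → ℚ) : ℚ := evalQ (kappaTerms p (thetaList p)) u
/-- READOUT FORM `R_p(u)` (demand side). [folklore] -/
def readoutForm (p : Site) (u : Fin 192 → ℚ) : ℚ := evalQ (readoutTerms p (thetaList p) betaTable) u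
/-- TRANSFERS of the λ = 2 tables. [folklore] -/
def transferLam2 (p : Site) (u : Fin 192 → ℚ) : ℚ := evalQ (transferTerms p tableClassesLam2) u

/-- `demand = kappaDemand + readoutForm` (definitional bookkeeping). [folklore] -/
theorem demand_eq (p : Site) (u : Fin 192 → ℚ) : demand p u = kappaDemand p u + readoutForm p u := rfl

/-- The λ = 2 certificate's term list: `S + T⁽²⁾ − 2K − R − m‖u‖² + Π`. [folklore] -/
def certTermsLam2 (p : Site) (m : ℚ) : List (Term 192) :=
  let ths := thetaList p
  supplyTerms p ths ++ transferTerms p tableClassesLam2 ++ negTerms (scaleTerms 2 (kappaTerms p ths)) ++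
    negTerms (readoutTerms p ths betaTable) ++ scaleTerms (-m) normTerms ++ projTerms

/-- The λ = 2 certificate's form is `S + T⁽²⁾ − 2K − R − m‖u‖² + Π`. [folklore] -/
theorem evalQ_certTermsLam2 (p : Site) (m : ℚ) (u : Fin 192 → ℚ) :
    evalQ (certTermsLam2 p m) u =
      supply p u + transferLam2 p u - 2 * kappaDemand p u - readoutForm p u - m * normSqG u + meanProj u := by
  simp only [certTermsLam2, evalQ_append, evalQ_negTerms, evalQ_scaleTerms, supply, transferLam2, kappaDemand, readoutForm,
    normSqG, meanProj]
  ring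

/-- Assembled symmetrised matrix, λ = 2, parity A. -/
def matA2 : Matrix (Fin 192) (Fin 192) ℚ := symm (assemble (certTermsLam2 siteA margin442lam2)).toMatrix
/-- Assembled symmetrised matrix, λ = 2, parity B. -/
def matB2 : Matrix (Fin 192) (Fin 192) ℚ := symm (assemble (certTermsLam2 siteB margin442lam2)).toMatrix
/-- Rounded `LDLᵀ` factor of `matA2 − 10⁻³·1`, computed in Lean. -/
def factA2 : Array ℚ × Array (Array ℚ) := certArrays 40 (1 / 1000) matA2
/-- Rounded `LDLᵀ` factor of `matB2 − 10⁻³·1`, computed in Lean. -/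
def factB2 : Array ℚ × Array (Array ℚ) := certArrays 40 (1 / 1000) matB2

/-- **Certificate, λ = 2, parity A** (COMPUTATIONAL, `native_decide`). -/
theorem certA2_valid : PSD.IsGramCertDD matA2 (vecOfArray 192 factA2.1) (matrixOfArrays 192 192 factA2.2) := by
  native_decide

/-- **Certificate, λ = 2, parity B** (COMPUTATIONAL, `native_decide`). -/
theorem certB2_valid : PSD.IsGramCertDD matB2 (vecOfArray 192 factB2.1) (matrixOfArrays 192 192 factB2.2) := by
  native_decide

/-- **κ-demand DOUBLED, A site of the 4×4×2 torus**: `2K_p(u) + R_p(u) + m₂‖u‖²_G ≤ S_p(u) + T⁽²⁾_p(u) + meanProj(u)` for every `u`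
(feasibility factor ≥ 2 of the registered constants on this finite model). -/
theorem jointLMI442A_kappaDoubled (u : Fin 192 → ℚ) :
    2 * kappaDemand siteA u + readoutForm siteA u + margin442lam2 * normSqG u ≤
      supply siteA u + transferLam2 siteA u + meanProj u := by
  have h := evalQ_nonneg_of_certDD (ts := certTermsLam2 siteA margin442lam2) rfl certA2_valid u
  rw [evalQ_certTermsLam2] at h
  linarith

/-- **κ-demand DOUBLED, B site.** -/
theorem jointLMI442B_kappaDoubled (u : Fin 192 → ℚ) :
    2 * kappaDemand siteB u + readoutForm siteB u + margin442lam2 * normSqG u ≤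
      supply siteB u + transferLam2 siteB u + meanProj u := by
  have h := evalQ_nonneg_of_certDD (ts := certTermsLam2 siteB margin442lam2) rfl certB2_valid u
  rw [evalQ_certTermsLam2] at h
  linarith

/-- **Zero-mean form, A site, κ doubled.** -/
theorem jointLMI442A_kappaDoubled_zeroMean (u : Fin 192 → ℚ) (h0 : ∀ c : Fin 3, (sumF c).eval u = 0) :
    2 * kappaDemand siteA u + readoutForm siteA u + margin442lam2 * normSqG u ≤ supply siteA u + transferLam2 siteA u := by
  have h := jointLMI442A_kappaDoubled u
  rw [meanProj_eq_zero h0, add_zero] at h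
  exact h

/-- **Zero-mean form, B site, κ doubled.** -/
theorem jointLMI442B_kappaDoubled_zeroMean (u : Fin 192 → ℚ) (h0 : ∀ c : Fin 3, (sumF c).eval u = 0) :
    2 * kappaDemand siteB u + readoutForm siteB u + margin442lam2 * normSqG u ≤ supply siteB u + transferLam2 siteB u := by
  have h := jointLMI442B_kappaDoubled u
  rw [meanProj_eq_zero h0, add_zero] at h
  exact h

end Summit.AtomisticToContinuum.Crystallization.Theorems.StrictSplittingRuleTorusLMI
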